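import Summits.BirchSwinnertonDyer.BirchSwinnertonDyer.Theses.BiquadraticEisensteinDescent
import Summits.BirchSwinnertonDyer.BirchSwinnertonDyer.Theorems.BiquadraticEisensteinDescentEisensteinDivisibilityCMInertBadFlatAtOneAbsIrr
import HarnessLib

/-!
# `BiquadraticEisensteinDescent.AbsIrrModPBaseChangeCMInert` holds (route BiquadraticEisensteinDescent, W-ALL row 12 · K12i;
# the support child of the split of crux (E♭°″) `EisensteinDivisibilityCMInertBadFlatAtOneKPrime`, recipe of record §2 (4))

The child decl `AbsIrrModPBaseChangeCMInert` (for `W/ℚ` CM, `p ≥ 5` CM-inert and bad, and any imaginary quadratic `K′` with the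
Heegner hypothesis for `N_W`: every `𝔽_p`-framing of `E[p]|_{G_{K′}}` is absolutely irreducible — Hsieh Thm. B hyp. (2)
verbatim) is, textually, the statement of the tree theorem
`…Theorems.BiquadraticEisensteinDescentEisensteinDivisibilityCMInertBadFlatAtOneAbsIrr.absIrrModPBaseChangeCMInert` (p526727,
bed-p1 g3: two Dirichlet primes inert in `K_CM`, split in `K′`, with opposite Legendre symbols at `p`; char polys via
`IsTorsionGaloisRep.charpoly_eq_of_isArithFrobAt`). So the item closes by ONE `exact`.

HONEST FRAMING: THEOREMS ONLY (0 definitions, 0 named facts, 0 `sorry`); unconditional. BSD is not proved by this file.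
Prover seat bsd-wall-bed-p2 (g7), 2026-08-27. References: [Mazur1978] §6; [SilvermanAEC2009] III §7; [Hsieh2014] Thm. B hyp. (2).
-/

set_option autoImplicit false

-- D-0017 layout: summit = sub-problem, so `Summit.BirchSwinnertonDyer.BirchSwinnertonDyer.…` is the mandated namespace.
set_option linter.dupNamespace false

namespace Summit.BirchSwinnertonDyer.BirchSwinnertonDyer.Theorems.BiquadraticEisensteinDescentAbsIrrModPBaseChangeCMInert

/-- **The support child `AbsIrrModPBaseChangeCMInert` holds**: for `W/ℚ` with CM, `p ≥ 5` inert in the CM field and bad, and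
any imaginary quadratic Heegner field `K′` for `N_W`, every framed mod-`p` torsion representation of `W/K′` is absolutely
irreducible. Proof: the tree theorem `…FlatAtOneAbsIrr.absIrrModPBaseChangeCMInert` (p526727) has exactly this type.
[cite: Hsieh2014, Thm. B hypothesis (2) p. 712 (Doc. Math. 19)] [cite: SilvermanAEC2009, III §7] -/
theorem absIrrModPBaseChangeCMInert_proof :
    Summit.BirchSwinnertonDyer.BirchSwinnertonDyer.Theses.BiquadraticEisensteinDescent.AbsIrrModPBaseChangeCMInert :=
  Summit.BirchSwinnertonDyer.BirchSwinnertonDyer.Theorems.BiquadraticEisensteinDescentEisensteinDivisibilityCMInertBadFlatAtOneAbsIrr.absIrrModPBaseChangeCMInert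

end Summit.BirchSwinnertonDyer.BirchSwinnertonDyer.Theorems.BiquadraticEisensteinDescentAbsIrrModPBaseChangeCMInert
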